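import Mathlib
import Summits.Ventures.LatticeQCDFlow.TrivializingMaps.SlotHilbert

/-!
# Disjoint unions of slot systems: tensor products (THEORY-1 §19.2 (E1)/(E4), file (5a))

HONEST FRAMING. Exact (Metropolis-corrected) sampling algorithms for lattice gauge theory; figures of
merit are autocorrelation/cost numbers at stated couplings and volumes; no continuum-physics claim.
This file is finite-dimensional linear algebra (Kronecker products); no analysis, no physics.

For two slot systems `(lnk₁, pol₁)` on `σ₁` and `(lnk₂, pol₂)` on `σ₂` over the same link set, the
system on `σ₁ ⊕ σ₂` (`Sum.elim lnk₁ lnk₂`, `Sum.elim pol₁ pol₂`) has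

* `slotRep_sum` : `R_{σ₁⊔σ₂}(W) = (R_{σ₁}(W) ⊗ 1)(1 ⊗ R_{σ₂}(W))` (`liftL`, `liftR` are the two
  Kronecker embeddings `A ↦ A ⊗ 1`, `B ↦ 1 ⊗ B`, which commute: `liftL_mul_liftR`, `liftR_mul_liftL`);
* `slotGen_sum` : `Y^{σ₁⊔σ₂,e} = Y^{σ₁,e} ⊗ 1 + 1 ⊗ Y^{σ₂,e}` — the `Y + Z` shape with `[Y, Z] = 0`
  that the eigenvalue shift `CasimirGrading.eigen_shift` (E4) is stated for;
* on vectors (`SlotHilbert.SlotSpace`): elementary tensors `tens x₁ x₂`, with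
  `‖tens x₁ x₂‖ = ‖x₁‖‖x₂‖` (`norm_tens`), `⟪tens y₁ y₂, tens x₁ x₂⟫ = ⟪y₁,x₁⟫⟪y₂,x₂⟫` (`inner_tens`),
  `R_{σ₁⊔σ₂}(W)(x₁ ⊗ x₂) = R x₁ ⊗ R x₂` (`repCLM_sum_tens`), the Leibniz rule
  `Y^{σ₁⊔σ₂,e}(x₁ ⊗ x₂) = Yx₁ ⊗ x₂ + x₁ ⊗ Yx₂` (`genCLM_sum_tens`), and hence
  PRODUCTS OF RANK-ONE COEFFICIENT FUNCTIONS ARE RANK-ONE COEFFICIENT FUNCTIONS: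
  `⟪y₁, R_{σ₁}(W)x₁⟫ · ⟪y₂, R_{σ₂}(W)x₂⟫ = ⟪y₁ ⊗ y₂, R_{σ₁⊔σ₂}(W)(x₁ ⊗ x₂)⟫` (`inner_repCLM_mul`) — the
  vertex `(∂S)(∂S̃^{(k)})` of Lüscher's recursion written on data, with masses multiplying.
[folklore (Kronecker products); the slot bookkeeping is ours]
-/

noncomputable section

namespace Summit.Ventures.LatticeQCDFlow.TrivializingMaps.SlotTensor

open scoped ComplexConjugate Matrix InnerProductSpace
open Finset
open Literature.MathematicalPhysics.QuantumFieldTheory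
open Literature.MathematicalPhysics.QuantumFieldTheory.Luscher2010
open SlotRepresentation SlotCasimir SlotHilbert

variable {n : ℕ} {σ₁ σ₂ : Type*} {E : Type*}

/-! ## 1. Multi-indices of a disjoint union -/

/-- A multi-index on `σ₁ ⊕ σ₂` is the pair of its restrictions. [folklore] -/
theorem elim_comp_eq (I : σ₁ ⊕ σ₂ → Fin n) : Sum.elim (I ∘ Sum.inl) (I ∘ Sum.inr) = I :=
  Sum.elim_comp_inl_inr I

/-- Restrictions of `Sum.elim`. [folklore] -/
theorem elim_comp_inl' (K₁ : σ₁ → Fin n) (K₂ : σ₂ → Fin n) : Sum.elim K₁ K₂ ∘ Sum.inl = K₁ :=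
  Sum.elim_comp_inl K₁ K₂

/-- Restrictions of `Sum.elim`. [folklore] -/
theorem elim_comp_inr' (K₁ : σ₁ → Fin n) (K₂ : σ₂ → Fin n) : Sum.elim K₁ K₂ ∘ Sum.inr = K₂ :=
  Sum.elim_comp_inr K₁ K₂

variable [Fintype σ₁] [Fintype σ₂]

/-- Kronecker products over a disjoint union factor entrywise. [folklore] -/
theorem kronPi_elim_apply (A : σ₁ → Matrix (Fin n) (Fin n) ℂ) (B : σ₂ → Matrix (Fin n) (Fin n) ℂ)
    (I J : σ₁ ⊕ σ₂ → Fin n) :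
    kronPi (Sum.elim A B) I J =
      kronPi A (I ∘ Sum.inl) (J ∘ Sum.inl) * kronPi B (I ∘ Sum.inr) (J ∘ Sum.inr) := by
  simp [kronPi_apply, Fintype.prod_sum_type]

/-! ## 2. The two Kronecker embeddings -/

/-- `A ↦ A ⊗ 1` on multi-indices of `σ₁ ⊕ σ₂`. [folklore] -/
def liftL (A : Matrix (σ₁ → Fin n) (σ₁ → Fin n) ℂ) : Matrix (σ₁ ⊕ σ₂ → Fin n) (σ₁ ⊕ σ₂ → Fin n) ℂ :=
  Matrix.of fun I J => A (I ∘ Sum.inl) (J ∘ Sum.inl) *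
    (1 : Matrix (σ₂ → Fin n) (σ₂ → Fin n) ℂ) (I ∘ Sum.inr) (J ∘ Sum.inr)

/-- `B ↦ 1 ⊗ B` on multi-indices of `σ₁ ⊕ σ₂`. [folklore] -/
def liftR (B : Matrix (σ₂ → Fin n) (σ₂ → Fin n) ℂ) : Matrix (σ₁ ⊕ σ₂ → Fin n) (σ₁ ⊕ σ₂ → Fin n) ℂ :=
  Matrix.of fun I J => (1 : Matrix (σ₁ → Fin n) (σ₁ → Fin n) ℂ) (I ∘ Sum.inl) (J ∘ Sum.inl) *
    B (I ∘ Sum.inr) (J ∘ Sum.inr)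

omit [Fintype σ₁] in
/-- Entries of `liftL`. [folklore] -/
@[simp] theorem liftL_apply (A : Matrix (σ₁ → Fin n) (σ₁ → Fin n) ℂ) (I J : σ₁ ⊕ σ₂ → Fin n) :
    liftL (σ₂ := σ₂) A I J = A (I ∘ Sum.inl) (J ∘ Sum.inl) *
      (1 : Matrix (σ₂ → Fin n) (σ₂ → Fin n) ℂ) (I ∘ Sum.inr) (J ∘ Sum.inr) := rfl

omit [Fintype σ₂] in
/-- Entries of `liftR`. [folklore] -/
@[simp] theorem liftR_apply (B : Matrix (σ₂ → Fin n) (σ₂ → Fin n) ℂ) (I J : σ₁ ⊕ σ₂ → Fin n) :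
    liftR (σ₁ := σ₁) B I J = (1 : Matrix (σ₁ → Fin n) (σ₁ → Fin n) ℂ) (I ∘ Sum.inl) (J ∘ Sum.inl) *
      B (I ∘ Sum.inr) (J ∘ Sum.inr) := rfl

omit [Fintype σ₁] in
/-- `liftL` is additive: finite sums. [folklore] -/
theorem liftL_sum {κ : Type*} (s : Finset κ) (A : κ → Matrix (σ₁ → Fin n) (σ₁ → Fin n) ℂ) :
    liftL (σ₂ := σ₂) (∑ i ∈ s, A i) = ∑ i ∈ s, liftL (A i) := by
  ext I J; simp [liftL_apply, Matrix.sum_apply, Finset.sum_mul]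

omit [Fintype σ₂] in
/-- `liftR` is additive: finite sums. [folklore] -/
theorem liftR_sum {κ : Type*} (s : Finset κ) (B : κ → Matrix (σ₂ → Fin n) (σ₂ → Fin n) ℂ) :
    liftR (σ₁ := σ₁) (∑ i ∈ s, B i) = ∑ i ∈ s, liftR (B i) := by
  ext I J; simp [liftR_apply, Matrix.sum_apply, Finset.mul_sum]

omit [Fintype σ₁] in
/-- `liftL 0 = 0`. [folklore] -/
@[simp] theorem liftL_zero : liftL (σ₂ := σ₂) (0 : Matrix (σ₁ → Fin n) (σ₁ → Fin n) ℂ) = 0 := by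
  ext I J; simp [liftL_apply]

omit [Fintype σ₂] in
/-- `liftR 0 = 0`. [folklore] -/
@[simp] theorem liftR_zero : liftR (σ₁ := σ₁) (0 : Matrix (σ₂ → Fin n) (σ₂ → Fin n) ℂ) = 0 := by
  ext I J; simp [liftR_apply]

variable [DecidableEq σ₁] [DecidableEq σ₂]

/-- A sum over multi-indices on `σ₁ ⊕ σ₂` is a double sum over pairs of multi-indices. [folklore] -/
theorem sum_sumArrow {M : Type*} [AddCommMonoid M] (f : (σ₁ ⊕ σ₂ → Fin n) → M) :
    ∑ K, f K = ∑ K₁ : σ₁ → Fin n, ∑ K₂ : σ₂ → Fin n, f (Sum.elim K₁ K₂) := by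
  rw [← (Equiv.sumArrowEquivProdArrow σ₁ σ₂ (Fin n)).symm.sum_comp, Fintype.sum_prod_type]
  rfl

/-- `(A ⊗ 1)(1 ⊗ B) = A ⊗ B` entrywise. [folklore] -/
theorem liftL_mul_liftR_apply (A : Matrix (σ₁ → Fin n) (σ₁ → Fin n) ℂ)
    (B : Matrix (σ₂ → Fin n) (σ₂ → Fin n) ℂ) (I J : σ₁ ⊕ σ₂ → Fin n) :
    (liftL (σ₂ := σ₂) A * liftR (σ₁ := σ₁) B) I J =
      A (I ∘ Sum.inl) (J ∘ Sum.inl) * B (I ∘ Sum.inr) (J ∘ Sum.inr) := by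
  rw [Matrix.mul_apply, sum_sumArrow]
  simp only [liftL_apply, liftR_apply, elim_comp_inl', elim_comp_inr', Matrix.one_apply,
    mul_ite, mul_one, mul_zero, ite_mul, one_mul, zero_mul]
  rw [Finset.sum_comm]
  simp only [Finset.sum_ite_eq, Finset.sum_ite_eq', Finset.mem_univ, if_true]

/-- `(1 ⊗ B)(A ⊗ 1) = A ⊗ B` entrywise. [folklore] -/
theorem liftR_mul_liftL_apply (A : Matrix (σ₁ → Fin n) (σ₁ → Fin n) ℂ)
    (B : Matrix (σ₂ → Fin n) (σ₂ → Fin n) ℂ) (I J : σ₁ ⊕ σ₂ → Fin n) :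
    (liftR (σ₁ := σ₁) B * liftL (σ₂ := σ₂) A) I J =
      A (I ∘ Sum.inl) (J ∘ Sum.inl) * B (I ∘ Sum.inr) (J ∘ Sum.inr) := by
  rw [Matrix.mul_apply, sum_sumArrow]
  simp only [liftL_apply, liftR_apply, elim_comp_inl', elim_comp_inr', Matrix.one_apply,
    mul_ite, mul_one, mul_zero, ite_mul, one_mul, zero_mul, Finset.sum_ite_eq, Finset.sum_ite_eq',
    Finset.mem_univ, if_true]
  ring

/-- **The two embeddings commute**: `[A ⊗ 1, 1 ⊗ B] = 0`. [folklore] -/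
theorem liftL_mul_liftR (A : Matrix (σ₁ → Fin n) (σ₁ → Fin n) ℂ)
    (B : Matrix (σ₂ → Fin n) (σ₂ → Fin n) ℂ) :
    liftL (σ₂ := σ₂) A * liftR (σ₁ := σ₁) B = liftR (σ₁ := σ₁) B * liftL (σ₂ := σ₂) A := by
  ext I J; rw [liftL_mul_liftR_apply, liftR_mul_liftL_apply]

/-- `liftL` is multiplicative. [folklore] -/
theorem liftL_mul (A A' : Matrix (σ₁ → Fin n) (σ₁ → Fin n) ℂ) :
    liftL (σ₂ := σ₂) (A * A') = liftL (σ₂ := σ₂) A * liftL (σ₂ := σ₂) A' := by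
  ext I J
  rw [Matrix.mul_apply, sum_sumArrow]
  simp only [liftL_apply, elim_comp_inl', elim_comp_inr', Matrix.one_apply, Matrix.mul_apply,
    mul_ite, mul_one, mul_zero, ite_mul, zero_mul, Finset.sum_ite_eq', Finset.mem_univ, if_true]
  by_cases h : I ∘ Sum.inr = J ∘ Sum.inr
  · simp [h]
  · simp [h]

/-- `liftR` is multiplicative. [folklore] -/
theorem liftR_mul (B B' : Matrix (σ₂ → Fin n) (σ₂ → Fin n) ℂ) :
    liftR (σ₁ := σ₁) (B * B') = liftR (σ₁ := σ₁) B * liftR (σ₁ := σ₁) B' := by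
  ext I J
  rw [Matrix.mul_apply, sum_sumArrow]
  simp only [liftR_apply, elim_comp_inl', elim_comp_inr', Matrix.one_apply, Matrix.mul_apply,
    mul_ite, mul_zero, ite_mul, one_mul, zero_mul, Finset.mul_sum]
  by_cases h : I ∘ Sum.inl = J ∘ Sum.inl
  · simp [h]
  · simp [h]

/-! ## 3. The slot representation and the generators of a disjoint union -/

section Systems
variable (lnk₁ : σ₁ → E) (pol₁ : σ₁ → Bool) (lnk₂ : σ₂ → E) (pol₂ : σ₂ → Bool)

omit [DecidableEq σ₁] [DecidableEq σ₂] in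
/-- Entries of the slot representation of `σ₁ ⊔ σ₂` factor. [folklore] -/
theorem slotRep_sum_apply (W : E → Matrix (Fin n) (Fin n) ℂ) (I J : σ₁ ⊕ σ₂ → Fin n) :
    slotRep (Sum.elim lnk₁ lnk₂) (Sum.elim pol₁ pol₂) W I J =
      slotRep lnk₁ pol₁ W (I ∘ Sum.inl) (J ∘ Sum.inl) * slotRep lnk₂ pol₂ W (I ∘ Sum.inr) (J ∘ Sum.inr) := by
  simp [slotRep, kronPi_apply, Fintype.prod_sum_type]

/-- **`R_{σ₁⊔σ₂}(W) = (R_{σ₁}(W) ⊗ 1)(1 ⊗ R_{σ₂}(W))`.** [folklore] -/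
theorem slotRep_sum (W : E → Matrix (Fin n) (Fin n) ℂ) :
    slotRep (Sum.elim lnk₁ lnk₂) (Sum.elim pol₁ pol₂) W =
      liftL (slotRep lnk₁ pol₁ W) * liftR (slotRep lnk₂ pol₂ W) := by
  ext I J; rw [slotRep_sum_apply, liftL_mul_liftR_apply]

/-- Slot insertion at a left slot is `ins ⊗ 1`. [folklore] -/
theorem ins_inl (s : σ₁) (Z : Matrix (Fin n) (Fin n) ℂ) :
    ins (σ := σ₁ ⊕ σ₂) (Sum.inl s) Z = liftL (ins s Z) := by
  have h : Function.update (fun _ : σ₁ ⊕ σ₂ => (1 : Matrix (Fin n) (Fin n) ℂ)) (Sum.inl s) Z =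
      Sum.elim (Function.update (fun _ => (1 : Matrix (Fin n) (Fin n) ℂ)) s Z) (fun _ => 1) := by
    funext t
    rcases t with a | b
    · by_cases ha : a = s
      · subst ha; simp
      · simp [Function.update_of_ne ha, Function.update_of_ne (Sum.inl_injective.ne ha)]
    · simp
  ext I J
  rw [ins, h, kronPi_elim_apply, liftL_apply, ins, kronPi_one]

/-- Slot insertion at a right slot is `1 ⊗ ins`. [folklore] -/
theorem ins_inr (s : σ₂) (Z : Matrix (Fin n) (Fin n) ℂ) :
    ins (σ := σ₁ ⊕ σ₂) (Sum.inr s) Z = liftR (ins s Z) := by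
  have h : Function.update (fun _ : σ₁ ⊕ σ₂ => (1 : Matrix (Fin n) (Fin n) ℂ)) (Sum.inr s) Z =
      Sum.elim (fun _ => 1) (Function.update (fun _ => (1 : Matrix (Fin n) (Fin n) ℂ)) s Z) := by
    funext t
    rcases t with a | b
    · simp
    · by_cases hb : b = s
      · subst hb; simp
      · simp [Function.update_of_ne hb, Function.update_of_ne (Sum.inr_injective.ne hb)]
  ext I J
  rw [ins, h, kronPi_elim_apply, liftR_apply, ins, kronPi_one]

variable [DecidableEq E]

/-- **`Y^{σ₁⊔σ₂,e} = Y^{σ₁,e} ⊗ 1 + 1 ⊗ Y^{σ₂,e}`** — the `Y + Z` decomposition of (E4), with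
`[Y ⊗ 1, 1 ⊗ Z] = 0` by `liftL_mul_liftR`. [folklore] -/
theorem slotGen_sum (e : E) (Y : Matrix (Fin n) (Fin n) ℂ) :
    slotGen (Sum.elim lnk₁ lnk₂) (Sum.elim pol₁ pol₂) e Y =
      liftL (slotGen lnk₁ pol₁ e Y) + liftR (slotGen lnk₂ pol₂ e Y) := by
  simp only [slotGen, Fintype.sum_sum_type, Sum.elim_inl, Sum.elim_inr, ins_inl, ins_inr,
    liftL_sum, liftR_sum]
  congr 1
  · refine Finset.sum_congr rfl fun s _ => ?_
    split_ifs <;> simp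
  · refine Finset.sum_congr rfl fun s _ => ?_
    split_ifs <;> simp

end Systems

/-! ## 4. Elementary tensors in the slot Hilbert space -/

/-- The elementary tensor `x₁ ⊗ x₂ ∈ ℓ²(σ₁ ⊕ σ₂ → Fin n)`. [folklore] -/
def tens (x₁ : SlotSpace σ₁ n) (x₂ : SlotSpace σ₂ n) : SlotSpace (σ₁ ⊕ σ₂) n :=
  WithLp.toLp 2 fun I => WithLp.ofLp x₁ (I ∘ Sum.inl) * WithLp.ofLp x₂ (I ∘ Sum.inr)

/-- Entries of an elementary tensor. [folklore] -/
@[simp] theorem ofLp_tens_apply (x₁ : SlotSpace σ₁ n) (x₂ : SlotSpace σ₂ n) (I : σ₁ ⊕ σ₂ → Fin n) :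
    WithLp.ofLp (tens x₁ x₂) I = WithLp.ofLp x₁ (I ∘ Sum.inl) * WithLp.ofLp x₂ (I ∘ Sum.inr) := rfl

/-- `tens` is additive on the left. [folklore] -/
theorem tens_add_left (x₁ x₁' : SlotSpace σ₁ n) (x₂ : SlotSpace σ₂ n) :
    tens (x₁ + x₁') x₂ = tens x₁ x₂ + tens x₁' x₂ := by
  apply (WithLp.ofLp_injective 2).eq_iff.1
  funext I; simp [add_mul]

/-- `tens` is additive on the right. [folklore] -/
theorem tens_add_right (x₁ : SlotSpace σ₁ n) (x₂ x₂' : SlotSpace σ₂ n) :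
    tens x₁ (x₂ + x₂') = tens x₁ x₂ + tens x₁ x₂' := by
  apply (WithLp.ofLp_injective 2).eq_iff.1
  funext I; simp [mul_add]

/-- `tens` is homogeneous on the left. [folklore] -/
theorem tens_smul_left (c : ℂ) (x₁ : SlotSpace σ₁ n) (x₂ : SlotSpace σ₂ n) :
    tens (c • x₁) x₂ = c • tens x₁ x₂ := by
  apply (WithLp.ofLp_injective 2).eq_iff.1
  funext I; simp [mul_assoc]

/-- `tens` is homogeneous on the right. [folklore] -/
theorem tens_smul_right (c : ℂ) (x₁ : SlotSpace σ₁ n) (x₂ : SlotSpace σ₂ n) :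
    tens x₁ (c • x₂) = c • tens x₁ x₂ := by
  apply (WithLp.ofLp_injective 2).eq_iff.1
  funext I; simp [mul_left_comm]

/-- `A ⊗ 1` acts on the left factor. [folklore] -/
theorem toE_liftL_tens (A : Matrix (σ₁ → Fin n) (σ₁ → Fin n) ℂ) (x₁ : SlotSpace σ₁ n)
    (x₂ : SlotSpace σ₂ n) : toE (liftL A) (tens x₁ x₂) = tens (toE A x₁) x₂ := by
  apply (WithLp.ofLp_injective 2).eq_iff.1
  rw [Matrix.ofLp_toEuclideanCLM]
  funext I
  rw [ofLp_tens_apply, Matrix.ofLp_toEuclideanCLM, Matrix.mulVec, dotProduct, sum_sumArrow,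
    Matrix.mulVec, dotProduct, Finset.sum_mul]
  refine Finset.sum_congr rfl fun K₁ _ => ?_
  simp only [liftL_apply, ofLp_tens_apply, elim_comp_inl', elim_comp_inr', Matrix.one_apply,
    mul_ite, mul_one, mul_zero, ite_mul, zero_mul, Finset.sum_ite_eq, Finset.mem_univ, if_true]
  ring

/-- `1 ⊗ B` acts on the right factor. [folklore] -/
theorem toE_liftR_tens (B : Matrix (σ₂ → Fin n) (σ₂ → Fin n) ℂ) (x₁ : SlotSpace σ₁ n)
    (x₂ : SlotSpace σ₂ n) : toE (liftR B) (tens x₁ x₂) = tens x₁ (toE B x₂) := by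
  apply (WithLp.ofLp_injective 2).eq_iff.1
  rw [Matrix.ofLp_toEuclideanCLM]
  funext I
  rw [ofLp_tens_apply, Matrix.ofLp_toEuclideanCLM, Matrix.mulVec, dotProduct, sum_sumArrow,
    Matrix.mulVec, dotProduct, Finset.mul_sum]
  rw [Finset.sum_comm]
  refine Finset.sum_congr rfl fun K₂ _ => ?_
  simp only [liftR_apply, ofLp_tens_apply, elim_comp_inl', elim_comp_inr', Matrix.one_apply,
    ite_mul, one_mul, zero_mul, Finset.sum_ite_eq, Finset.mem_univ, if_true]
  ring

/-- **Inner products of elementary tensors multiply.** [folklore] -/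
theorem inner_tens (y₁ x₁ : SlotSpace σ₁ n) (y₂ x₂ : SlotSpace σ₂ n) :
    ⟪tens y₁ y₂, tens x₁ x₂⟫_ℂ = ⟪y₁, x₁⟫_ℂ * ⟪y₂, x₂⟫_ℂ := by
  simp only [PiLp.inner_apply, RCLike.inner_apply, sum_sumArrow, Finset.sum_mul_sum]
  refine Finset.sum_congr rfl fun K₁ _ => Finset.sum_congr rfl fun K₂ _ => ?_
  simp only [ofLp_tens_apply, elim_comp_inl', elim_comp_inr', map_mul]
  ring

/-- **Norms of elementary tensors multiply.** [folklore] -/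
theorem norm_tens (x₁ : SlotSpace σ₁ n) (x₂ : SlotSpace σ₂ n) : ‖tens x₁ x₂‖ = ‖x₁‖ * ‖x₂‖ := by
  have h : ‖tens x₁ x₂‖ ^ 2 = (‖x₁‖ * ‖x₂‖) ^ 2 := by
    rw [← inner_self_eq_norm_sq (𝕜 := ℂ) (tens x₁ x₂), inner_tens, RCLike.mul_re]
    simp only [inner_self_im, mul_zero, sub_zero, inner_self_eq_norm_sq]
    ring
  exact (sq_eq_sq₀ (norm_nonneg _) (mul_nonneg (norm_nonneg _) (norm_nonneg _))).1 h

/-! ## 5. Consequences for slot systems on vectors -/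

section OnVectors
variable (lnk₁ : σ₁ → E) (pol₁ : σ₁ → Bool) (lnk₂ : σ₂ → E) (pol₂ : σ₂ → Bool)

/-- **`R_{σ₁⊔σ₂}(W)(x₁ ⊗ x₂) = R_{σ₁}(W)x₁ ⊗ R_{σ₂}(W)x₂`.** [folklore] -/
theorem repCLM_sum_tens (W : E → Matrix (Fin n) (Fin n) ℂ) (x₁ : SlotSpace σ₁ n) (x₂ : SlotSpace σ₂ n) :
    repCLM (Sum.elim lnk₁ lnk₂) (Sum.elim pol₁ pol₂) W (tens x₁ x₂) =
      tens (repCLM lnk₁ pol₁ W x₁) (repCLM lnk₂ pol₂ W x₂) := by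
  rw [repCLM, slotRep_sum, toE_mul, ContinuousLinearMap.comp_apply, toE_liftR_tens, toE_liftL_tens]

/-- **Products of rank-one coefficient functions are rank-one coefficient functions** on the disjoint
union, with elementary-tensor vectors. [folklore] -/
theorem inner_repCLM_mul (W : E → Matrix (Fin n) (Fin n) ℂ) (y₁ x₁ : SlotSpace σ₁ n)
    (y₂ x₂ : SlotSpace σ₂ n) :
    ⟪y₁, repCLM lnk₁ pol₁ W x₁⟫_ℂ * ⟪y₂, repCLM lnk₂ pol₂ W x₂⟫_ℂ =
      ⟪tens y₁ y₂, repCLM (Sum.elim lnk₁ lnk₂) (Sum.elim pol₁ pol₂) W (tens x₁ x₂)⟫_ℂ := by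
  rw [repCLM_sum_tens, inner_tens]

variable [DecidableEq E]

/-- **Leibniz rule**: `Y^{σ₁⊔σ₂,e}(x₁ ⊗ x₂) = Y^{σ₁,e}x₁ ⊗ x₂ + x₁ ⊗ Y^{σ₂,e}x₂`. [folklore] -/
theorem genCLM_sum_tens (e : E) (Y : Matrix (Fin n) (Fin n) ℂ) (x₁ : SlotSpace σ₁ n)
    (x₂ : SlotSpace σ₂ n) :
    genCLM (Sum.elim lnk₁ lnk₂) (Sum.elim pol₁ pol₂) e Y (tens x₁ x₂) =
      tens (genCLM lnk₁ pol₁ e Y x₁) x₂ + tens x₁ (genCLM lnk₂ pol₂ e Y x₂) := by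
  rw [genCLM, slotGen_sum, ← toE_liftL_tens, ← toE_liftR_tens]
  show toE (liftL (slotGen lnk₁ pol₁ e Y) + liftR (slotGen lnk₂ pol₂ e Y)) (tens x₁ x₂) = _
  rw [show toE (liftL (slotGen lnk₁ pol₁ e Y) + liftR (slotGen lnk₂ pol₂ e Y)) =
      toE (liftL (slotGen lnk₁ pol₁ e Y)) + toE (σ := σ₁ ⊕ σ₂) (liftR (slotGen lnk₂ pol₂ e Y)) from
    map_add _ _ _]
  rfl

end OnVectors

end Summit.Ventures.LatticeQCDFlow.TrivializingMaps.SlotTensor
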